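import Summits.CriticalPhenomena.PercolationContinuityZ3.Theorems.PercNearOneGluingNoHeavyLowerTailIncStarApexForestSchema
import Summits.CriticalPhenomena.PercolationContinuityZ3.Theorems.PercNearOneGluingNoHeavyLowerTailIncStarHalfNonRootDet
import HarnessLib

/-!
# THEOREM C½ (schema): STAR½ on every apex-forest, from the B½ chord inequality

Support file for the Sahi programme (`--supports stmt-CriticalPhenomena-4575`, prover prim-sahi-p2 gen 19).  No definitions, no named
facts, no sorries; standard axioms.  Memo `FROM-prim-nh-lead-4575-g120-STAR-HALF.md` (lead g120) and `prim-sahi-p2/PROOF-E3.md` (29i)–(29m).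

Write `F(μ; A, B, C) = E₃(A, B, C) − ½(μ(A∩B∩C) − μ(A)μ(B)μ(C))` (STAR½ is `F ≥ 0` for the root-connection events `{s↔a}, {s↔b}, {s↔c}`).
This file is THEOREM C's induction (`IncStar.incStar_nonneg_of_apexForest_of_bridgeChord`, file `…IncStarApexForestSchema`) verbatim
with `F` in place of `E₃`: strong induction on the number of fractional non-root pairs of an apex-forest weight; moves
`apexForest_blobHalf` (two-terminal blob reduction preserves `F`, by `SahiBlobReduction.real_principal_blobReduce`) and
`apexForest_chordHalf` (the B½ chord inequality, hypothesis `hB` — discharged in `…IncStarHalfForest` by `IncStar.incStar_bridge_chordHalf`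
+ RS-forest `IncStar.rs_nonneg`); base `IncStar.starHalf_nonneg_of_nonRootDet`; targets at the root `IncStar.starHalf_nonneg_of_univ`.
-/

noncomputable section

namespace Summit.CriticalPhenomena.PercolationContinuityZ3.Theorems

namespace IncStar

open MeasureTheory Set Literature.Probability.Percolation Literature.Probability.LatticeModels EdgeInduction
open scoped Classical

variable {n : ℕ}

/-- `F ≥ 0` when the first target is the root (`{s↔s}` is sure; Harris). [this work] -/
theorem starHalf_nonneg_of_target_eq_root (w : Sym2 (Fin n) → unitInterval) (s b c : Fin n) :
    0 ≤ (sahiE3 (prodBernoulli w) (openConn s s) (openConn s b) (openConn s c)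
        - 1 / 2 * ((prodBernoulli w).real (openConn s s ∩ openConn s b ∩ openConn s c)
          - (prodBernoulli w).real (openConn s s) * (prodBernoulli w).real (openConn s b) * (prodBernoulli w).real (openConn s c))) := by
  have hss : (openConn s s : Set (BondConfig (Fin n))) = Set.univ := Set.eq_univ_of_forall fun _ => SimpleGraph.Reachable.refl s
  rw [hss]
  exact starHalf_nonneg_of_univ w (isUpperSet_openConn s b) (isUpperSet_openConn s c) MeasurableSet.of_discrete MeasurableSet.of_discrete

/-- **Blob move for `F`.**  As `IncStar.apexForest_blob`, with `F` preserved (blob reduction preserves the joint law of the three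
root-connection events: `SahiBlobReduction.sahiE3_incStar_blobReduce`, `SahiBlobReduction.real_principal_blobReduce`). [this work] -/
theorem apexForest_blobHalf (w : Sym2 (Fin n) → unitInterval) {s t t' a b c : Fin n} (hts : t ≠ s) (ht's : t' ≠ s)
    (hfrac : s(t, t') ∈ (fracEdges w).filter fun z => ¬ z.IsDiag ∧ s ∉ z)
    (hbridge : ¬ ((SimpleGraph.fromEdgeSet {z : Sym2 (Fin n) | s ∉ z ∧ w z ≠ 0}).deleteEdges {s(t, t')}).Reachable t t')
    (ha : ¬ ((SimpleGraph.fromEdgeSet {z : Sym2 (Fin n) | s ∉ z ∧ w z ≠ 0}).deleteEdges {s(t, t')}).Reachable t a)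
    (hb : ¬ ((SimpleGraph.fromEdgeSet {z : Sym2 (Fin n) | s ∉ z ∧ w z ≠ 0}).deleteEdges {s(t, t')}).Reachable t b)
    (hc : ¬ ((SimpleGraph.fromEdgeSet {z : Sym2 (Fin n) | s ∉ z ∧ w z ≠ 0}).deleteEdges {s(t, t')}).Reachable t c) :
    ∃ w' : Sym2 (Fin n) → unitInterval,
      (sahiE3 (prodBernoulli w) (openConn s a) (openConn s b) (openConn s c)
        - 1 / 2 * ((prodBernoulli w).real (openConn s a ∩ openConn s b ∩ openConn s c)
          - (prodBernoulli w).real (openConn s a) * (prodBernoulli w).real (openConn s b) * (prodBernoulli w).real (openConn s c)))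
          = (sahiE3 (prodBernoulli w') (openConn s a) (openConn s b) (openConn s c)
        - 1 / 2 * ((prodBernoulli w').real (openConn s a ∩ openConn s b ∩ openConn s c)
          - (prodBernoulli w').real (openConn s a) * (prodBernoulli w').real (openConn s b) * (prodBernoulli w').real (openConn s c))) ∧
        SimpleGraph.fromEdgeSet {z : Sym2 (Fin n) | s ∉ z ∧ w' z ≠ 0}
          ≤ SimpleGraph.fromEdgeSet {z : Sym2 (Fin n) | s ∉ z ∧ w z ≠ 0} ∧
        ((fracEdges w').filter fun z => ¬ z.IsDiag ∧ s ∉ z).card < ((fracEdges w).filter fun z => ¬ z.IsDiag ∧ s ∉ z).card := by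
  set H' := (SimpleGraph.fromEdgeSet {z : Sym2 (Fin n) | s ∉ z ∧ w z ≠ 0}).deleteEdges {s(t, t')}
  set B : Finset (Fin n) := Finset.univ.filter fun x => H'.Reachable t x with hB
  have hmemB : ∀ x, x ∈ B ↔ H'.Reachable t x := fun x => by simp [hB]
  have hsB : s ∉ B := fun h => apexForest_root_not_mem w hts _ ((hmemB s).1 h)
  have ht'B : t' ∉ B := fun h => hbridge ((hmemB t').1 h)
  have htB : t ∈ B := (hmemB t).2 (SimpleGraph.Reachable.refl t)
  have hst' : s ≠ t' := ht's.symm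
  have haB : a ∉ B := fun h => ha ((hmemB a).1 h)
  have hbB : b ∉ B := fun h => hb ((hmemB b).1 h)
  have hcB : c ∉ B := fun h => hc ((hmemB c).1 h)
  have hwB : ∀ x ∈ B, ∀ y, y ∉ B → y ≠ s → y ≠ t' → w s(x, y) = 0 := by
    intro x hx y hy hys hyt'
    refine apexForest_cross w hts {s(t, t')} ((hmemB x).1 hx) (fun h => hy ((hmemB y).2 h)) hys fun hD => ?_
    rw [Set.mem_singleton_iff, Sym2.eq_iff] at hD
    rcases hD with ⟨-, h⟩ | ⟨h, -⟩
    · exact hyt' h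
    · exact ht'B (h ▸ hx)
  obtain ⟨w', h1, h2, h3, -⟩ := SahiBlobReduction.exists_blobReduce w B hsB ht'B hst' hwB
  have hE := SahiBlobReduction.sahiE3_incStar_blobReduce w w' B hsB ht'B hst' hsB hwB h1 h2 h3 haB hbB hcB
  have hP : ∀ U : Finset (Fin n), (∀ x ∈ U, x ∉ B) →
      (prodBernoulli w).real (⋂ x ∈ U, (openConn s x : Set (BondConfig (Fin n))))
        = (prodBernoulli w').real (⋂ x ∈ U, (openConn s x : Set (BondConfig (Fin n)))) :=
    fun U hU => SahiBlobReduction.real_principal_blobReduce w w' B hsB ht'B hst' hsB hwB h1 h2 h3 U hU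
  have i1 : ∀ x : Fin n, (⋂ y ∈ ({x} : Finset (Fin n)), (openConn s y : Set (BondConfig (Fin n)))) = openConn s x := by
    intro x; ext ω; simp
  have i3 : (⋂ y ∈ ({a, b, c} : Finset (Fin n)), (openConn s y : Set (BondConfig (Fin n))))
      = openConn s a ∩ openConn s b ∩ openConn s c := by
    ext ω
    simp only [Finset.mem_insert, Finset.mem_singleton, Set.mem_iInter, Set.mem_inter_iff]
    constructor
    · intro h
      exact ⟨⟨h a (Or.inl rfl), h b (Or.inr (Or.inl rfl))⟩, h c (Or.inr (Or.inr rfl))⟩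
    · rintro ⟨⟨h1, h2⟩, h3⟩ y hy
      rcases hy with rfl | rfl | rfl
      · exact h1
      · exact h2
      · exact h3
  have hA := hP {a} fun x hx => by rw [Finset.mem_singleton] at hx; rw [hx]; exact haB
  have hBt := hP {b} fun x hx => by rw [Finset.mem_singleton] at hx; rw [hx]; exact hbB
  have hC := hP {c} fun x hx => by rw [Finset.mem_singleton] at hx; rw [hx]; exact hcB
  have hABC := hP {a, b, c} fun x hx => by
    simp only [Finset.mem_insert, Finset.mem_singleton] at hx
    rcases hx with rfl | rfl | rfl
    · exact haB
    · exact hbB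
    · exact hcB
  rw [i1] at hA hBt hC
  rw [i3] at hABC
  refine ⟨w', by rw [hE, hA, hBt, hC, hABC], ?_, ?_⟩
  · -- the environment only shrinks
    intro x y hxy
    rw [SimpleGraph.fromEdgeSet_adj] at hxy ⊢
    obtain ⟨⟨hsxy, hw'⟩, hxy'⟩ := hxy
    have hxB : x ∉ B := fun h => hw' (h1 x h y)
    have hyB : y ∉ B := fun h => hw' (by rw [Sym2.eq_swap]; exact h1 y h x)
    have hne : s(x, y) ≠ s(s, t') := fun h => hsxy (h ▸ Sym2.mem_mk_left s t')
    rw [h2 _ (fun x' hx' hmem => ?_) hne] at hw'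
    · exact ⟨⟨hsxy, hw'⟩, hxy'⟩
    · rcases Sym2.mem_iff.1 hmem with rfl | rfl
      · exact hxB hx'
      · exact hyB hx'
  · -- fewer fractional non-root pairs
    apply Finset.card_lt_card
    refine ⟨fun f hf => ?_, fun hsub => ?_⟩
    · rw [Finset.mem_filter] at hf ⊢
      obtain ⟨hff, hfd, hfs⟩ := hf
      have hfB : ∀ x' ∈ B, x' ∉ f := by
        intro x' hx' hx'f
        obtain ⟨y', rfl⟩ := SahiBlobReduction.exists_eq_mk_of_mem hx'f
        have h0 := h1 x' hx' y'
        simp only [fracEdges, Finset.mem_filter, Finset.mem_univ, true_and] at hff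
        rw [h0] at hff
        simp at hff
      have hne : f ≠ s(s, t') := fun h => hfs (h ▸ Sym2.mem_mk_left s t')
      refine ⟨?_, hfd, hfs⟩
      simp only [fracEdges, Finset.mem_filter, Finset.mem_univ, true_and] at hff ⊢
      rwa [h2 f hfB hne] at hff
    · have h := Finset.mem_filter.1 (hsub hfrac)
      have h0 := h1 t htB t'
      simp only [fracEdges, Finset.mem_filter, Finset.mem_univ, true_and] at h
      rw [h0] at h
      simp at h

/-- **Chord move for `F`.** [this work] -/
theorem apexForest_chordHalf (w : Sym2 (Fin n) → unitInterval) (L : Set (Fin n)) {s u v a b c : Fin n}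
    (hB : ∀ (w : Sym2 (Fin n) → unitInterval) (L : Set (Fin n)) (s u v a b c : Fin n),
      s ∉ L → u ∈ L → v ∉ L → a ∈ L → b ∉ L → c ∉ L → u ≠ s → v ≠ s →
      (∀ x y : Fin n, x ∈ L → y ∉ L → y ≠ s → s(x, y) ≠ s(u, v) → w s(x, y) = 0) →
      (SimpleGraph.fromEdgeSet {z : Sym2 (Fin n) | s ∉ z ∧ w z ≠ 0}).IsAcyclic →
      (1 - (w s(u, v) : ℝ)) * (sahiE3 (prodBernoulli (Function.update w s(u, v) 0)) (openConn s a) (openConn s b) (openConn s c)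
            - 1 / 2 * ((prodBernoulli (Function.update w s(u, v) 0)).real (openConn s a ∩ openConn s b ∩ openConn s c)
              - (prodBernoulli (Function.update w s(u, v) 0)).real (openConn s a) * (prodBernoulli (Function.update w s(u, v) 0)).real (openConn s b) * (prodBernoulli (Function.update w s(u, v) 0)).real (openConn s c)))
        + (w s(u, v) : ℝ) * (sahiE3 (prodBernoulli (Function.update w s(u, v) 1)) (openConn s a) (openConn s b) (openConn s c)
            - 1 / 2 * ((prodBernoulli (Function.update w s(u, v) 1)).real (openConn s a ∩ openConn s b ∩ openConn s c)
              - (prodBernoulli (Function.update w s(u, v) 1)).real (openConn s a) * (prodBernoulli (Function.update w s(u, v) 1)).real (openConn s b) * (prodBernoulli (Function.update w s(u, v) 1)).real (openConn s c)))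
      ≤ (sahiE3 (prodBernoulli w) (openConn s a) (openConn s b) (openConn s c)
          - 1 / 2 * ((prodBernoulli w).real (openConn s a ∩ openConn s b ∩ openConn s c)
            - (prodBernoulli w).real (openConn s a) * (prodBernoulli w).real (openConn s b) * (prodBernoulli w).real (openConn s c))))
    (hsL : s ∉ L) (huL : u ∈ L) (hvL : v ∉ L) (hus : u ≠ s) (hvs : v ≠ s)
    (hcross : ∀ x y : Fin n, x ∈ L → y ∉ L → y ≠ s → s(x, y) ≠ s(u, v) → w s(x, y) = 0)
    (hforest : (SimpleGraph.fromEdgeSet {z : Sym2 (Fin n) | s ∉ z ∧ w z ≠ 0}).IsAcyclic)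
    (hone : (a ∈ L ∧ b ∉ L ∧ c ∉ L) ∨ (b ∈ L ∧ a ∉ L ∧ c ∉ L) ∨ (c ∈ L ∧ a ∉ L ∧ b ∉ L))
    (h0 : 0 ≤ (sahiE3 (prodBernoulli (Function.update w s(u, v) 0)) (openConn s a) (openConn s b) (openConn s c)
        - 1 / 2 * ((prodBernoulli (Function.update w s(u, v) 0)).real (openConn s a ∩ openConn s b ∩ openConn s c)
          - (prodBernoulli (Function.update w s(u, v) 0)).real (openConn s a) * (prodBernoulli (Function.update w s(u, v) 0)).real (openConn s b) * (prodBernoulli (Function.update w s(u, v) 0)).real (openConn s c))))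
    (h1 : 0 ≤ (sahiE3 (prodBernoulli (Function.update w s(u, v) 1)) (openConn s a) (openConn s b) (openConn s c)
        - 1 / 2 * ((prodBernoulli (Function.update w s(u, v) 1)).real (openConn s a ∩ openConn s b ∩ openConn s c)
          - (prodBernoulli (Function.update w s(u, v) 1)).real (openConn s a) * (prodBernoulli (Function.update w s(u, v) 1)).real (openConn s b) * (prodBernoulli (Function.update w s(u, v) 1)).real (openConn s c)))) :
    0 ≤ (sahiE3 (prodBernoulli w) (openConn s a) (openConn s b) (openConn s c)
        - 1 / 2 * ((prodBernoulli w).real (openConn s a ∩ openConn s b ∩ openConn s c)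
          - (prodBernoulli w).real (openConn s a) * (prodBernoulli w).real (openConn s b) * (prodBernoulli w).real (openConn s c))) := by
  have hp0 : (0 : ℝ) ≤ w s(u, v) := (w s(u, v)).2.1
  have hp1 : (w s(u, v) : ℝ) ≤ 1 := (w s(u, v)).2.2
  rcases hone with ⟨ha, hb, hc⟩ | ⟨hb, ha, hc⟩ | ⟨hc, ha, hb⟩
  · have h := hB w L s u v a b c hsL huL hvL ha hb hc hus hvs hcross hforest
    nlinarith [mul_nonneg (sub_nonneg.2 hp1) h0, mul_nonneg hp0 h1]
  · have h := hB w L s u v b a c hsL huL hvL hb ha hc hus hvs hcross hforest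
    rw [starHalf_comm₁₂ _ (openConn s a) (openConn s b) (openConn s c)] at h0 h1 ⊢
    nlinarith [mul_nonneg (sub_nonneg.2 hp1) h0, mul_nonneg hp0 h1]
  · have h := hB w L s u v c a b hsL huL hvL hc ha hb hus hvs hcross hforest
    rw [starHalf_comm₂₃ _ (openConn s a) (openConn s b) (openConn s c),
      starHalf_comm₁₂ _ (openConn s a) (openConn s c) (openConn s b)] at h0 h1 ⊢
    nlinarith [mul_nonneg (sub_nonneg.2 hp1) h0, mul_nonneg hp0 h1]

/-- **THEOREM C½, schema form: STAR½ `F ≥ 0` holds on every apex-forest, granted the B½ chord inequality `hB` for apex-forest weights.**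
[this work] -/
theorem starHalf_nonneg_of_apexForest_of_chordHalf
    (hB : ∀ (w : Sym2 (Fin n) → unitInterval) (L : Set (Fin n)) (s u v a b c : Fin n),
      s ∉ L → u ∈ L → v ∉ L → a ∈ L → b ∉ L → c ∉ L → u ≠ s → v ≠ s →
      (∀ x y : Fin n, x ∈ L → y ∉ L → y ≠ s → s(x, y) ≠ s(u, v) → w s(x, y) = 0) →
      (SimpleGraph.fromEdgeSet {z : Sym2 (Fin n) | s ∉ z ∧ w z ≠ 0}).IsAcyclic →
      (1 - (w s(u, v) : ℝ)) * (sahiE3 (prodBernoulli (Function.update w s(u, v) 0)) (openConn s a) (openConn s b) (openConn s c)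
            - 1 / 2 * ((prodBernoulli (Function.update w s(u, v) 0)).real (openConn s a ∩ openConn s b ∩ openConn s c)
              - (prodBernoulli (Function.update w s(u, v) 0)).real (openConn s a) * (prodBernoulli (Function.update w s(u, v) 0)).real (openConn s b) * (prodBernoulli (Function.update w s(u, v) 0)).real (openConn s c)))
        + (w s(u, v) : ℝ) * (sahiE3 (prodBernoulli (Function.update w s(u, v) 1)) (openConn s a) (openConn s b) (openConn s c)
            - 1 / 2 * ((prodBernoulli (Function.update w s(u, v) 1)).real (openConn s a ∩ openConn s b ∩ openConn s c)
              - (prodBernoulli (Function.update w s(u, v) 1)).real (openConn s a) * (prodBernoulli (Function.update w s(u, v) 1)).real (openConn s b) * (prodBernoulli (Function.update w s(u, v) 1)).real (openConn s c)))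
      ≤ (sahiE3 (prodBernoulli w) (openConn s a) (openConn s b) (openConn s c)
          - 1 / 2 * ((prodBernoulli w).real (openConn s a ∩ openConn s b ∩ openConn s c)
            - (prodBernoulli w).real (openConn s a) * (prodBernoulli w).real (openConn s b) * (prodBernoulli w).real (openConn s c))))
    (w : Sym2 (Fin n) → unitInterval) (s a b c : Fin n)
    (hforest : (SimpleGraph.fromEdgeSet {z : Sym2 (Fin n) | s ∉ z ∧ w z ≠ 0}).IsAcyclic) :
    0 ≤ (sahiE3 (prodBernoulli w) (openConn s a) (openConn s b) (openConn s c)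
        - 1 / 2 * ((prodBernoulli w).real (openConn s a ∩ openConn s b ∩ openConn s c)
          - (prodBernoulli w).real (openConn s a) * (prodBernoulli w).real (openConn s b) * (prodBernoulli w).real (openConn s c))) := by
  -- targets at the root
  by_cases has : a = s
  · subst has; exact starHalf_nonneg_of_target_eq_root w a b c
  by_cases hbs : b = s
  · subst hbs; rw [starHalf_comm₁₂]; exact starHalf_nonneg_of_target_eq_root w b a c
  by_cases hcs : c = s
  · subst hcs; rw [starHalf_comm₂₃, starHalf_comm₁₂]; exact starHalf_nonneg_of_target_eq_root w c a b
  -- strong induction on the number of fractional non-root off-diagonal pairs, over all targets missing the root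
  suffices H : ∀ (N : ℕ) (w : Sym2 (Fin n) → unitInterval) (a b c : Fin n), a ≠ s → b ≠ s → c ≠ s →
      (SimpleGraph.fromEdgeSet {z : Sym2 (Fin n) | s ∉ z ∧ w z ≠ 0}).IsAcyclic →
      ((fracEdges w).filter fun z => ¬ z.IsDiag ∧ s ∉ z).card ≤ N →
      0 ≤ (sahiE3 (prodBernoulli w) (openConn s a) (openConn s b) (openConn s c)
        - 1 / 2 * ((prodBernoulli w).real (openConn s a ∩ openConn s b ∩ openConn s c)
          - (prodBernoulli w).real (openConn s a) * (prodBernoulli w).real (openConn s b) * (prodBernoulli w).real (openConn s c))) from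
    H _ w a b c has hbs hcs hforest le_rfl
  intro N
  induction N with
  | zero =>
    intro w a b c _ _ _ _ hN
    refine starHalf_nonneg_of_nonRootDet w s a b c fun z hzd hsz => eq_zero_or_one_of_not_mem_fracEdges fun hz => ?_
    have hmem : z ∈ (fracEdges w).filter (fun z => ¬ z.IsDiag ∧ s ∉ z) := Finset.mem_filter.2 ⟨hz, hzd, hsz⟩
    have := Finset.card_pos.2 ⟨z, hmem⟩
    omega
  | succ N ih =>
    intro w a b c has hbs hcs hforest hN
    by_cases hempty : ((fracEdges w).filter fun z => ¬ z.IsDiag ∧ s ∉ z) = ∅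
    · exact ih w a b c has hbs hcs hforest (by rw [hempty, Finset.card_empty]; exact Nat.zero_le _)
    obtain ⟨z, hz⟩ := Finset.nonempty_iff_ne_empty.2 hempty
    have IH : ∀ (w' : Sym2 (Fin n) → unitInterval),
        (SimpleGraph.fromEdgeSet {z : Sym2 (Fin n) | s ∉ z ∧ w' z ≠ 0}).IsAcyclic →
        ((fracEdges w').filter fun z => ¬ z.IsDiag ∧ s ∉ z).card < ((fracEdges w).filter fun z => ¬ z.IsDiag ∧ s ∉ z).card →
        0 ≤ (sahiE3 (prodBernoulli w') (openConn s a) (openConn s b) (openConn s c)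
        - 1 / 2 * ((prodBernoulli w').real (openConn s a ∩ openConn s b ∩ openConn s c)
          - (prodBernoulli w').real (openConn s a) * (prodBernoulli w').real (openConn s b) * (prodBernoulli w').real (openConn s c))) :=
      fun w' hf hlt => ih w' a b c has hbs hcs hf (by omega)
    -- the chosen fractional environment pair `z = s(u,v)`
    obtain ⟨⟨u, v⟩, rfl⟩ := Quot.exists_rep z
    obtain ⟨hzf, hzd, hzs⟩ := Finset.mem_filter.1 hz
    have huv : u ≠ v := fun h => hzd (Sym2.mk_isDiag_iff.2 h)
    have hus : u ≠ s := fun h => hzs (h ▸ Sym2.mem_mk_left u v)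
    have hvs : v ≠ s := fun h => hzs (h ▸ Sym2.mem_mk_right u v)
    have hw0 : w s(u, v) ≠ 0 := by
      intro h
      simp only [fracEdges, Finset.mem_filter, Finset.mem_univ, true_and] at hzf
      rw [h] at hzf
      simp at hzf
    set H := SimpleGraph.fromEdgeSet {z : Sym2 (Fin n) | s ∉ z ∧ w z ≠ 0} with hH
    have hadj : H.Adj u v := by
      rw [hH, SimpleGraph.fromEdgeSet_adj]; exact ⟨⟨hzs, hw0⟩, huv⟩
    have hbridge : ¬ (H.deleteEdges {s(u, v)}).Reachable u v :=
      SimpleGraph.isBridge_iff.1 (SimpleGraph.isAcyclic_iff_forall_adj_isBridge.1 hforest hadj)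
    have hz' : s(v, u) ∈ (fracEdges w).filter (fun z => ¬ z.IsDiag ∧ s ∉ z) := by rw [Sym2.eq_swap]; exact hz
    have hbridge' : ¬ (H.deleteEdges {s(v, u)}).Reachable v u := by
      rw [Sym2.eq_swap]; exact fun h => hbridge h.symm
    -- the two pinned weights are apex-forests with fewer fractional pairs
    have h0 : 0 ≤ (sahiE3 (prodBernoulli (Function.update w s(u, v) 0)) (openConn s a) (openConn s b) (openConn s c)
        - 1 / 2 * ((prodBernoulli (Function.update w s(u, v) 0)).real (openConn s a ∩ openConn s b ∩ openConn s c)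
          - (prodBernoulli (Function.update w s(u, v) 0)).real (openConn s a) * (prodBernoulli (Function.update w s(u, v) 0)).real (openConn s b) * (prodBernoulli (Function.update w s(u, v) 0)).real (openConn s c))) :=
      IH _ (hforest.anti (envGraph_update_le w s _ 0 (Or.inr rfl))) (fracNR_card_update_lt w s hz 0 (Or.inl rfl))
    have h1 : 0 ≤ (sahiE3 (prodBernoulli (Function.update w s(u, v) 1)) (openConn s a) (openConn s b) (openConn s c)
        - 1 / 2 * ((prodBernoulli (Function.update w s(u, v) 1)).real (openConn s a ∩ openConn s b ∩ openConn s c)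
          - (prodBernoulli (Function.update w s(u, v) 1)).real (openConn s a) * (prodBernoulli (Function.update w s(u, v) 1)).real (openConn s b) * (prodBernoulli (Function.update w s(u, v) 1)).real (openConn s c))) :=
      IH _ (hforest.anti (envGraph_update_le w s _ 1 (Or.inl hw0))) (fracNR_card_update_lt w s hz 1 (Or.inr rfl))
    have h0' : 0 ≤ (sahiE3 (prodBernoulli (Function.update w s(v, u) 0)) (openConn s a) (openConn s b) (openConn s c)
        - 1 / 2 * ((prodBernoulli (Function.update w s(v, u) 0)).real (openConn s a ∩ openConn s b ∩ openConn s c)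
          - (prodBernoulli (Function.update w s(v, u) 0)).real (openConn s a) * (prodBernoulli (Function.update w s(v, u) 0)).real (openConn s b) * (prodBernoulli (Function.update w s(v, u) 0)).real (openConn s c))) := by
      rw [Sym2.eq_swap]; exact h0
    have h1' : 0 ≤ (sahiE3 (prodBernoulli (Function.update w s(v, u) 1)) (openConn s a) (openConn s b) (openConn s c)
        - 1 / 2 * ((prodBernoulli (Function.update w s(v, u) 1)).real (openConn s a ∩ openConn s b ∩ openConn s c)
          - (prodBernoulli (Function.update w s(v, u) 1)).real (openConn s a) * (prodBernoulli (Function.update w s(v, u) 1)).real (openConn s b) * (prodBernoulli (Function.update w s(v, u) 1)).real (openConn s c))) := by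
      rw [Sym2.eq_swap]; exact h1
    -- the component of `u`, and its mirror
    set L : Set (Fin n) := {x | (H.deleteEdges {s(u, v)}).Reachable u x}
    have hsL : s ∉ L := apexForest_root_not_mem w hus _
    have huL : u ∈ L := SimpleGraph.Reachable.refl u
    have hvL : v ∉ L := hbridge
    have hcross : ∀ x y : Fin n, x ∈ L → y ∉ L → y ≠ s → s(x, y) ≠ s(u, v) → w s(x, y) = 0 :=
      fun x y hx hy hys hne => apexForest_cross w hus {s(u, v)} hx hy hys (by rwa [Set.mem_singleton_iff])
    set M : Set (Fin n) := {x | x ∉ L ∧ x ≠ s}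
    have hsM : s ∉ M := fun h => h.2 rfl
    have hvM : v ∈ M := ⟨hvL, hvs⟩
    have huM : u ∉ M := fun h => h.1 huL
    have hcrossM : ∀ x y : Fin n, x ∈ M → y ∉ M → y ≠ s → s(x, y) ≠ s(v, u) → w s(x, y) = 0 := by
      intro x y hx hy hys hne
      have hyL : y ∈ L := by
        by_contra h
        exact hy ⟨h, hys⟩
      rw [Sym2.eq_swap]
      exact hcross y x hyL hx.1 hx.2 fun h => hne (Sym2.eq_swap.trans (h.trans Sym2.eq_swap))
    have haM : a ∉ L → a ∈ M := fun h => ⟨h, has⟩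
    have hbM : b ∉ L → b ∈ M := fun h => ⟨h, hbs⟩
    have hcM : c ∉ L → c ∈ M := fun h => ⟨h, hcs⟩
    have nM : ∀ {x : Fin n}, x ∈ L → x ∉ M := fun hx h => h.1 hx
    -- eight cases
    by_cases haL : a ∈ L <;> by_cases hbL : b ∈ L <;> by_cases hcL : c ∈ L
    · -- all three near: blob-reduce the component of `v`
      have hfar : ∀ {x : Fin n}, x ∈ L → ¬ (H.deleteEdges {s(v, u)}).Reachable v x := by
        intro x hx h
        rw [Sym2.eq_swap] at h
        exact hbridge (SimpleGraph.Reachable.trans hx h.symm)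
      obtain ⟨w', hE, hle, hlt⟩ := apexForest_blobHalf w hvs hus hz' hbridge' (hfar haL) (hfar hbL) (hfar hcL)
      rw [hE]; exact IH w' (hforest.anti hle) hlt
    · exact apexForest_chordHalf w M hB hsM hvM huM hvs hus hcrossM hforest (Or.inr (Or.inr ⟨hcM hcL, nM haL, nM hbL⟩)) h0' h1'
    · exact apexForest_chordHalf w M hB hsM hvM huM hvs hus hcrossM hforest (Or.inr (Or.inl ⟨hbM hbL, nM haL, nM hcL⟩)) h0' h1'
    · exact apexForest_chordHalf w L hB hsL huL hvL hus hvs hcross hforest (Or.inl ⟨haL, hbL, hcL⟩) h0 h1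
    · exact apexForest_chordHalf w M hB hsM hvM huM hvs hus hcrossM hforest (Or.inl ⟨haM haL, nM hbL, nM hcL⟩) h0' h1'
    · exact apexForest_chordHalf w L hB hsL huL hvL hus hvs hcross hforest (Or.inr (Or.inl ⟨hbL, haL, hcL⟩)) h0 h1
    · exact apexForest_chordHalf w L hB hsL huL hvL hus hvs hcross hforest (Or.inr (Or.inr ⟨hcL, haL, hbL⟩)) h0 h1
    · -- none near: blob-reduce the component of `u`
      obtain ⟨w', hE, hle, hlt⟩ := apexForest_blobHalf w hus hvs hz hbridge haL hbL hcL
      rw [hE]; exact IH w' (hforest.anti hle) hlt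

end IncStar

end Summit.CriticalPhenomena.PercolationContinuityZ3.Theorems
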